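import Summits.Schanuel.Schanuel.Theorems.RootDecomp1KHeightMachine01

/-!
# RootDecomp1KHeightMachine — lens 1, generation 53, NODE 13 «THE HEIGHT MACHINE ON THE LINE: node 12's antecedent DISCHARGED, HYPOTHESIS-FREE, on the two ℙ¹-uniformised territory classes» (RULE K-R42 (vii′), K-R44) — continuation (RootDecomp1KHeightMachine02): §3 CLASS I correspondence curves (A⁺/B⁺/B⁼), §4 CLASS II ℚ-parametrised curves (A′/B′/B′⁼)

(lens-1 g53 NODE 13 HOME kernel K = HOME/decomp-schanuel-lens-1/g53/HeightMachine.lean eb09d600…, 1515 l, 171 thm + 12 def, imports tree …RootDecomp1KHeightGrading04 + Literature.NumberTheory.DiophantineGeometry.RationalFunctionHeight ONLY; Probe / Ctrl0 / Ctrl + NODE-g53.md + SHA256SUMS + the lens's K-R44 certificate g53/liveness/ (census instrument liveness3.py); CLAIM L2587, crit EX-ANTE PRICE L2588 (ONE THEOREM ×1 under RULE K-R42 (vii′) «an infinite territory class becomes UNCONDITIONAL» iff CHECKLIST K-g53; RULE K-R44 liveness certificate), NODE L2595 / REQUEST L2596, census STAGING NOTE 3 L2597 + CONFIRM L2598 (L13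 liveness row; dedup pre-scan 0 homonyms), critic VERDICT L2599: CLEARED — THEOREM ×1 under RULE K-R42 (vii′) (A⁺ ∧ A′ jointly; the (P2) label earned inside the credit by L13); CHECKLIST K-g53 met; RULE K-R44 fixed with the census instrument LIVENESS-v3 as certificate format; PORT GO (credit port, verbatim; conditions: dedup scan clean, provenance block, cite-token spelling). Port by census-1 gen 22 as `RootDecomp1KHeightMachine01–05` (`--supports stmt-Schanuel-33364`; no census credit): 01 = §1 the INPUT `exists_logHt_div_sub_le` (Silverman AEC VIII.5.6 on ℙ¹ over ℚ — the tree's PROVED Literature theorem `exists_abs_logHeight₁_div_sub_le_finrank` at k = K = ℚ through node 12's `logHt_eq_logHeight₁`; NO binder, NO hypothesis def) + §2 the two transfer tails (`clause_of_transfer`, `not_clause_of_transfer(_le)`, boundary tail `not_clause_of_upper_height_le`); 02 = §3 CLASS I correspondence curves **`thinFibreAt_of_corr`** (A⁺) / `thinFibreAt_iff_bddLevelEmpty_of_corr(_le)` (B⁺, B⁼) / `thinFibreAt_or_iff_bddLevelEmpty_of_corr` + `CorrAt`, `corrP` + §4 CLASS II ℚ-parametrised curves **`thinFibreAt_of_param`**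 (A′) / B′ / B′⁼ + `ParamAt`; 03 = §5 the class-I member `M13` (illustration; costume test at m₀ = 2, 3); 04 = §5b the LIVE class-I member `L13` (K-R44 certificate LIFTS; costume test); 05 = §6 the class-II member `R13` (x = t³ + t, y = t + 1/t; LIFTS, exp 1/3) + §7 the residual of record RE-GRADED ×0 (`MachineDecidedAt`, `MachineOffAt`, `MachineHeightOffAt`, `thinFibre_of_machineOffAt`, …). PORT EDITS: none needed on decls (K fully documented, no private, no set_option, no cite-token); provenance doc blocks + continuation headers = K's own open-lines only; statements and proofs VERBATIM. Rung 0 — nothing here proves Schanuel, 33364, 33363, 31077 or ThinFibre 2; classes I/II are HYPOTHESIS-FREE, the rest of §7 is conditional on PadicSubspace / HeightComparison.)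
-/

noncomputable section

namespace Summit.Schanuel.Schanuel.Theorems.RootDecomp1KHeightMachine

open Polynomial LiouvilleNumber
open scoped Nat
open Summit.Schanuel.Schanuel.Theorems.RootDecomp1KSkelCell (SkelLiouvilleFix)
open Summit.Schanuel.Schanuel.Theorems.RootDecomp1KTwoBaseCell (psNumer partialSum_eq_psNumer_div coprime_psNumer
  partialSum_pos' partialSum_lt_two)
open Summit.Schanuel.Schanuel.Theorems.RootDecomp1KDegreeLadder
open Summit.Schanuel.Schanuel.Theorems.RootDecomp1KXLinearCore
open Summit.Schanuel.Schanuel.Theorems.RootDecomp1KXLinear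
open Summit.Schanuel.Schanuel.Theorems.RootDecomp1KXLinearII
open Summit.Schanuel.Schanuel.Theorems.RootDecomp1KXTop
open Summit.Schanuel.Schanuel.Theorems.RootDecomp1KXAll
open Summit.Schanuel.Schanuel.Theorems.RootDecomp1KLevelFinite
open Summit.Schanuel.Schanuel.Theorems.RootDecomp1KSubspaceBranch
open Summit.Schanuel.Schanuel.Theorems.RootDecomp1KHeightGrading

/-! ### §3  CLASS I — correspondence curves `f∘y = g∘x` (`f = F₁/F₂`, `g = G₁/G₂`): THEOREMS A⁺ / B⁺, hypothesis-free -/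

/-- **the transfer inequalities on a correspondence curve.**  `P ∈ ℤ[x][Y]`; `(F₁, F₂)`, `(G₁, G₂)` coprime pairs in
`ℚ[t]` with `max deg Fᵢ = dF`, `max deg Gᵢ = dG ≥ 1`; EVERY rational point `(x, y)` of `P = 0` satisfies
`F₁(y)·G₂(x) = F₂(y)·G₁(x)` (i.e. `f(y) = g(x)` off the poles).  Then at every rational point `(x_N, r)` of every
large level BOTH `dG·h(x_N) − c ≤ dF·h(r)` and `dF·h(r) ≤ dG·h(x_N) + c`.  (No exceptional set: a pole `G₂(x_N) = 0`
would give `dG·h(x_N) ≤ C`, impossible on a large level; then `F₂(r) = 0` would force the common root `F₁(r) = 0`.) -/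
theorem corr_transfer {P : ℤ[X][X]} {F₁ F₂ G₁ G₂ : ℚ[X]} (hF : IsCoprime F₁ F₂) (hG : IsCoprime G₁ G₂)
    (hrel : ∀ x y : ℚ, bev P x y = 0 → aeval y F₁ * aeval x G₂ = aeval y F₂ * aeval x G₁)
    {dF dG : ℕ} (hdF : max F₁.natDegree F₂.natDegree = dF) (hdG : max G₁.natDegree G₂.natDegree = dG)
    (hdG1 : 1 ≤ dG) :
    ∃ c : ℝ, ∃ N₁ : ℕ, ∀ N : ℕ, N₁ ≤ N → ∀ r : ℚ, bev P (partialSum 2 N) r = 0 →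
      ((dG : ℝ) * logHt (xQ N) - c ≤ dF * logHt r) ∧ ((dF : ℝ) * logHt r ≤ dG * logHt (xQ N) + c) := by
  obtain ⟨CF, hCF⟩ := logHt_div_bounds' hF hdF
  obtain ⟨CG, hCG⟩ := logHt_div_bounds' hG hdG
  obtain ⟨N₂, hN₂⟩ := eventually_le_factorial_log (CG + 1)
  refine ⟨CF + CG, max N₂ 2, fun N hN r hroot => ?_⟩
  have hN2 : N₂ ≤ N := le_trans (le_max_left _ _) hN
  have h2 : 2 ≤ N := le_trans (le_max_right _ _) hN
  have hx := le_logHt_xQ h2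
  have hB := hN₂ N hN2
  have hdG1' : (1 : ℝ) ≤ dG := by exact_mod_cast hdG1
  have hroot' : bev P ((xQ N : ℚ) : ℝ) (r : ℝ) = 0 := by rw [xQ_cast]; exact hroot
  have hR := hrel (xQ N) r hroot'
  -- no pole of `g` at `x_N` (large level) …
  have hG2 : aeval (xQ N) G₂ ≠ 0 := by
    intro h0
    have hb := logHt_le_of_pole hCG h0
    have hL0 : 0 ≤ (N ! : ℝ) * Real.log 2 := by positivity
    have e1 : 1 * logHt (xQ N) ≤ (dG : ℝ) * logHt (xQ N) := mul_le_mul_of_nonneg_right hdG1' (hL0.trans hx)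
    linarith
  -- … hence no pole of `f` at `r` (coprimality)
  have hF2 : aeval r F₂ ≠ 0 := by
    intro h0
    have h1 := ne_zero_of_isCoprime_of_eq_zero hF h0
    rw [h0, zero_mul] at hR
    exact mul_ne_zero h1 hG2 hR
  -- `f(r) = g(x_N)`
  have hfg : aeval r F₁ / aeval r F₂ = aeval (xQ N) G₁ / aeval (xQ N) G₂ := by
    rw [div_eq_div_iff hF2 hG2, hR, mul_comm]
  have hf := hCF r
  have hg := hCG (xQ N)
  rw [hfg] at hf
  constructor <;> linarith [hf.1, hf.2, hg.1, hg.2]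

/-- **THEOREM A⁺ (class I, hypothesis-free).**  If every rational point of `P = 0` lies on the correspondence
`F₁(y)·G₂(x) = F₂(y)·G₁(x)` of coprime pairs with `dF = max deg Fᵢ < m₀ · dG`, `dG = max deg Gᵢ`, then
`ThinFibreAt m₀ P` — for EVERY `m₀`, every top `x`-coefficient (any `ℚ₂`-multiplicity `μ`, any order `e` at `(∞,∞)`),
any `x`-support, any genus; NO `GeomIrreducible`, NO `HeightComparison`.  (Node 12's THEOREM A with `(n, k) := (dF, dG)`,
its binder replaced by the Literature theorem on `ℙ¹`.) -/
theorem thinFibreAt_of_corr {P : ℤ[X][X]} {F₁ F₂ G₁ G₂ : ℚ[X]} (hF : IsCoprime F₁ F₂) (hG : IsCoprime G₁ G₂)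
    (hrel : ∀ x y : ℚ, bev P x y = 0 → aeval y F₁ * aeval x G₂ = aeval y F₂ * aeval x G₁)
    {dF dG : ℕ} (hdF : max F₁.natDegree F₂.natDegree = dF) (hdG : max G₁.natDegree G₂.natDegree = dG)
    {m₀ : ℕ} (hlt : dF < m₀ * dG) : ThinFibreAt m₀ P := by
  have hdG1 : 1 ≤ dG := by
    rcases Nat.eq_zero_or_pos dG with h | h
    · subst h; simp at hlt
    · exact h
  obtain ⟨c, N₁, htr⟩ := corr_transfer hF hG hrel hdF hdG hdG1
  exact thinFibreAt_of_transfer (fun N hN r hroot => (htr N hN r hroot).1) hlt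

/-- **THEOREM B⁺ (class I, hypothesis-free).**  Same data with `m₀ · dG < dF` (`m₀, dG ≥ 1`):
`ThinFibreAt m₀ P ↔ BddLevelEmpty P` — there the clause IS eventual emptiness of the bounded fibres
(`←` is the tree's `thinFibreAt_of_bddLevelEmpty`). -/
theorem thinFibreAt_iff_bddLevelEmpty_of_corr {P : ℤ[X][X]} {F₁ F₂ G₁ G₂ : ℚ[X]} (hF : IsCoprime F₁ F₂)
    (hG : IsCoprime G₁ G₂)
    (hrel : ∀ x y : ℚ, bev P x y = 0 → aeval y F₁ * aeval x G₂ = aeval y F₂ * aeval x G₁)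
    {dF dG : ℕ} (hdF : max F₁.natDegree F₂.natDegree = dF) (hdG : max G₁.natDegree G₂.natDegree = dG)
    (hdG1 : 1 ≤ dG) {m₀ : ℕ} (hm : 1 ≤ m₀) (hlt : m₀ * dG < dF) : ThinFibreAt m₀ P ↔ BddLevelEmpty P := by
  obtain ⟨c, N₁, htr⟩ := corr_transfer hF hG hrel hdF hdG hdG1
  exact ⟨bddLevelEmpty_of_thinFibreAt_of_transfer (fun N hN r hroot => (htr N hN r hroot).2) hm hlt,
    fun h => thinFibreAt_of_bddLevelEmpty h m₀⟩

/-- THEOREM B⁺ in the tree's wording: `ThinFibreAt m₀ P ↔ LevelFinite P`. -/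
theorem thinFibreAt_iff_levelFinite_of_corr {P : ℤ[X][X]} {F₁ F₂ G₁ G₂ : ℚ[X]} (hF : IsCoprime F₁ F₂)
    (hG : IsCoprime G₁ G₂)
    (hrel : ∀ x y : ℚ, bev P x y = 0 → aeval y F₁ * aeval x G₂ = aeval y F₂ * aeval x G₁)
    {dF dG : ℕ} (hdF : max F₁.natDegree F₂.natDegree = dF) (hdG : max G₁.natDegree G₂.natDegree = dG)
    (hdG1 : 1 ≤ dG) {m₀ : ℕ} (hm : 1 ≤ m₀) (hlt : m₀ * dG < dF) : ThinFibreAt m₀ P ↔ LevelFinite P :=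
  (thinFibreAt_iff_bddLevelEmpty_of_corr hF hG hrel hdF hdG hdG1 hm hlt).trans (bddLevelEmpty_iff_levelFinite P)

/-- **THEOREM B⁼ (class I, BOUNDARY INCLUDED, every `m₀`).**  Same data as A⁺ with `1 ≤ dG` and `m₀ · dG ≤ dF`:
`ThinFibreAt m₀ P ↔ BddLevelEmpty P` — at the boundary `dF = m₀·dG` the exact transfer (no ε) still kills the clause at
every rational point of a large level (`not_clause_of_upper_height_le`).  Supersedes B⁺ (no `1 ≤ m₀`, non-strict). -/
theorem thinFibreAt_iff_bddLevelEmpty_of_corr_le {P : ℤ[X][X]} {F₁ F₂ G₁ G₂ : ℚ[X]} (hF : IsCoprime F₁ F₂)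
    (hG : IsCoprime G₁ G₂)
    (hrel : ∀ x y : ℚ, bev P x y = 0 → aeval y F₁ * aeval x G₂ = aeval y F₂ * aeval x G₁)
    {dF dG : ℕ} (hdF : max F₁.natDegree F₂.natDegree = dF) (hdG : max G₁.natDegree G₂.natDegree = dG)
    (hdG1 : 1 ≤ dG) {m₀ : ℕ} (hle : m₀ * dG ≤ dF) : ThinFibreAt m₀ P ↔ BddLevelEmpty P := by
  obtain ⟨c, N₁, htr⟩ := corr_transfer hF hG hrel hdF hdG hdG1
  exact ⟨bddLevelEmpty_of_thinFibreAt_of_transfer_le (fun N hN r hroot => (htr N hN r hroot).2) hdG1 hle,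
    fun h => thinFibreAt_of_bddLevelEmpty h m₀⟩

/-- B⁼ in the tree's wording: `ThinFibreAt m₀ P ↔ LevelFinite P` for `1 ≤ dG`, `m₀ · dG ≤ dF`. -/
theorem thinFibreAt_iff_levelFinite_of_corr_le {P : ℤ[X][X]} {F₁ F₂ G₁ G₂ : ℚ[X]} (hF : IsCoprime F₁ F₂)
    (hG : IsCoprime G₁ G₂)
    (hrel : ∀ x y : ℚ, bev P x y = 0 → aeval y F₁ * aeval x G₂ = aeval y F₂ * aeval x G₁)
    {dF dG : ℕ} (hdF : max F₁.natDegree F₂.natDegree = dF) (hdG : max G₁.natDegree G₂.natDegree = dG)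
    (hdG1 : 1 ≤ dG) {m₀ : ℕ} (hle : m₀ * dG ≤ dF) : ThinFibreAt m₀ P ↔ LevelFinite P :=
  (thinFibreAt_iff_bddLevelEmpty_of_corr_le hF hG hrel hdF hdG hdG1 hle).trans (bddLevelEmpty_iff_levelFinite P)

/-- **COMPLETE DICHOTOMY on class I (no undecided boundary).**  For a correspondence with `1 ≤ dG` and EVERY `m₀`:
either the thin-fibre clause HOLDS (`dF < m₀·dG`, A⁺), or it is EQUIVALENT to eventual emptiness of the bounded levels
(`m₀·dG ≤ dF`, B⁼). -/
theorem thinFibreAt_or_iff_bddLevelEmpty_of_corr {P : ℤ[X][X]} {F₁ F₂ G₁ G₂ : ℚ[X]} (hF : IsCoprime F₁ F₂)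
    (hG : IsCoprime G₁ G₂)
    (hrel : ∀ x y : ℚ, bev P x y = 0 → aeval y F₁ * aeval x G₂ = aeval y F₂ * aeval x G₁)
    {dF dG : ℕ} (hdF : max F₁.natDegree F₂.natDegree = dF) (hdG : max G₁.natDegree G₂.natDegree = dG)
    (hdG1 : 1 ≤ dG) (m₀ : ℕ) : ThinFibreAt m₀ P ∨ (ThinFibreAt m₀ P ↔ BddLevelEmpty P) := by
  rcases Nat.lt_or_ge dF (m₀ * dG) with h | h
  · exact Or.inl (thinFibreAt_of_corr hF hG hrel hdF hdG h)
  · exact Or.inr (thinFibreAt_iff_bddLevelEmpty_of_corr_le hF hG hrel hdF hdG hdG1 h)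

/-- [class] definition (census convention): **the CORRESPONDENCE CLASS at quality `m₀`** — the rational points of
`P = 0` lie on a correspondence `F₁(y)·G₂(x) = F₂(y)·G₁(x)` (`f∘y = g∘x`, `f = F₁/F₂`, `g = G₁/G₂` coprime pairs
over `ℚ`) of degrees `dF < m₀ · dG`.  (Semantic: only the rational points of `P` are constrained.) -/
def CorrAt (m₀ : ℕ) (P : ℤ[X][X]) : Prop :=
  ∃ F₁ F₂ G₁ G₂ : ℚ[X], IsCoprime F₁ F₂ ∧ IsCoprime G₁ G₂ ∧
    max F₁.natDegree F₂.natDegree < m₀ * max G₁.natDegree G₂.natDegree ∧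
    ∀ x y : ℚ, bev P x y = 0 → aeval y F₁ * aeval x G₂ = aeval y F₂ * aeval x G₁

/-- **every curve of the correspondence class is decided at `m₀` — hypothesis-free.** -/
theorem thinFibreAt_of_corrAt {m₀ : ℕ} {P : ℤ[X][X]} (h : CorrAt m₀ P) : ThinFibreAt m₀ P := by
  obtain ⟨F₁, F₂, G₁, G₂, hF, hG, hlt, hrel⟩ := h
  exact thinFibreAt_of_corr hF hG hrel rfl rfl hlt

/-- the classes increase with `m₀`. -/
theorem CorrAt.mono {m₀ m : ℕ} (hle : m₀ ≤ m) {P : ℤ[X][X]} (h : CorrAt m₀ P) : CorrAt m P := by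
  obtain ⟨F₁, F₂, G₁, G₂, hF, hG, hlt, hrel⟩ := h
  exact ⟨F₁, F₂, G₁, G₂, hF, hG, lt_of_lt_of_le hlt (Nat.mul_le_mul_right _ hle), hrel⟩

/-! #### The syntactic sub-family `F₁(Y)·G₂(x) − F₂(Y)·G₁(x)` (`Fᵢ ∈ ℤ[Y]`, `Gᵢ ∈ ℤ[x]`) -/

/-- the correspondence curve `F₁(Y)·G₂(x) − F₂(Y)·G₁(x) ∈ ℤ[x][Y]` (outer variable `Y`, coefficients in `ℤ[x]`). -/
def corrP (F₁ F₂ G₁ G₂ : ℤ[X]) : ℤ[X][X] :=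
  Polynomial.map C F₁ * C G₂ - Polynomial.map C F₂ * C G₁

/-- `(F₁(Y)G₂(x) − F₂(Y)G₁(x))(x, y) = F₁(y)G₂(x) − F₂(y)G₁(x)`. -/
theorem bev_corrP (F₁ F₂ G₁ G₂ : ℤ[X]) (x y : ℝ) :
    bev (corrP F₁ F₂ G₁ G₂) x y = aeval y F₁ * aeval x G₂ - aeval y F₂ * aeval x G₁ := by
  rw [corrP, bev_sub, bev_mul, bev_mul, bev_map_C, bev_map_C, bev_C, bev_C]

/-- the rational points of `corrP F₁ F₂ G₁ G₂` satisfy the correspondence relation (over `ℚ`). -/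
theorem rel_corrP (F₁ F₂ G₁ G₂ : ℤ[X]) (x y : ℚ) (h : bev (corrP F₁ F₂ G₁ G₂) x y = 0) :
    aeval y (F₁.map (Int.castRingHom ℚ)) * aeval x (G₂.map (Int.castRingHom ℚ)) =
      aeval y (F₂.map (Int.castRingHom ℚ)) * aeval x (G₁.map (Int.castRingHom ℚ)) := by
  rw [aeval_mapQ, aeval_mapQ, aeval_mapQ, aeval_mapQ]
  rw [bev_corrP, ← aeval_ratCast, ← aeval_ratCast, ← aeval_ratCast, ← aeval_ratCast] at h
  exact_mod_cast (sub_eq_zero.mp h)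

/-- **the whole syntactic family decided, hypothesis-free**: `(F₁, F₂)`, `(G₁, G₂)` coprime over `ℚ`,
`max deg Fᵢ < m₀ · max deg Gᵢ` ⇒ `ThinFibreAt m₀ (F₁(Y)G₂(x) − F₂(Y)G₁(x))`.  (The two-term curves
`x^k·B(Y) − A(Y)` of the tree's x-lacunary ladder are the monomial case `g = x^k`; see the header, §0 (h2).) -/
theorem thinFibreAt_corrP (F₁ F₂ G₁ G₂ : ℤ[X])
    (hF : IsCoprime (F₁.map (Int.castRingHom ℚ)) (F₂.map (Int.castRingHom ℚ)))
    (hG : IsCoprime (G₁.map (Int.castRingHom ℚ)) (G₂.map (Int.castRingHom ℚ))) {m₀ : ℕ}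
    (hlt : max F₁.natDegree F₂.natDegree < m₀ * max G₁.natDegree G₂.natDegree) :
    ThinFibreAt m₀ (corrP F₁ F₂ G₁ G₂) := by
  refine thinFibreAt_of_corr hF hG (fun x y h => rel_corrP F₁ F₂ G₁ G₂ x y h) rfl rfl ?_
  rwa [natDegree_mapQ, natDegree_mapQ, natDegree_mapQ, natDegree_mapQ]

/-- `corrP F₁ F₂ G₁ G₂ ∈ CorrAt m₀` under the same degree inequality. -/
theorem corrAt_corrP (F₁ F₂ G₁ G₂ : ℤ[X])
    (hF : IsCoprime (F₁.map (Int.castRingHom ℚ)) (F₂.map (Int.castRingHom ℚ)))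
    (hG : IsCoprime (G₁.map (Int.castRingHom ℚ)) (G₂.map (Int.castRingHom ℚ))) {m₀ : ℕ}
    (hlt : max F₁.natDegree F₂.natDegree < m₀ * max G₁.natDegree G₂.natDegree) :
    CorrAt m₀ (corrP F₁ F₂ G₁ G₂) := by
  refine ⟨_, _, _, _, hF, hG, ?_, fun x y h => rel_corrP F₁ F₂ G₁ G₂ x y h⟩
  rwa [natDegree_mapQ, natDegree_mapQ, natDegree_mapQ, natDegree_mapQ]

/-! ### §4  CLASS II — `ℚ`-parametrised curves `x = φ(t)`, `y = ψ(t)`: THEOREMS A′ / B′, hypothesis-free -/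

/-- **the transfer inequalities on a `ℚ`-parametrised curve.**  `φ = φ₁/φ₂`, `ψ = ψ₁/ψ₂` coprime pairs over `ℚ`
with `max deg φᵢ = dφ`, `max deg ψᵢ = dψ`; every rational point of `P = 0` is `(φ(t), ψ(t))` for some `t ∈ ℚ`,
except possibly points whose abscissa has height `≤ B` (a finite set).  Then at the rational points of all large
levels `dψ·h(x_N) − c ≤ dφ·h(r)` and `dφ·h(r) ≤ dψ·h(x_N) + c`. -/
theorem param_transfer {P : ℤ[X][X]} {φ₁ φ₂ ψ₁ ψ₂ : ℚ[X]} (hφ : IsCoprime φ₁ φ₂) (hψ : IsCoprime ψ₁ ψ₂) {B : ℝ}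
    (hpar : ∀ x y : ℚ, bev P x y = 0 → logHt x ≤ B ∨
      ∃ t : ℚ, aeval t φ₁ / aeval t φ₂ = x ∧ aeval t ψ₁ / aeval t ψ₂ = y)
    {dφ dψ : ℕ} (hdφ : max φ₁.natDegree φ₂.natDegree = dφ) (hdψ : max ψ₁.natDegree ψ₂.natDegree = dψ) :
    ∃ c : ℝ, ∃ N₁ : ℕ, ∀ N : ℕ, N₁ ≤ N → ∀ r : ℚ, bev P (partialSum 2 N) r = 0 →
      ((dψ : ℝ) * logHt (xQ N) - c ≤ dφ * logHt r) ∧ ((dφ : ℝ) * logHt r ≤ dψ * logHt (xQ N) + c) := by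
  obtain ⟨Cφ, hCφ⟩ := logHt_div_bounds' hφ hdφ
  obtain ⟨Cψ, hCψ⟩ := logHt_div_bounds' hψ hdψ
  obtain ⟨N₂, hN₂⟩ := eventually_le_factorial_log (B + 1)
  refine ⟨dφ * Cψ + dψ * Cφ, max N₂ 2, fun N hN r hroot => ?_⟩
  have hN2 : N₂ ≤ N := le_trans (le_max_left _ _) hN
  have h2 : 2 ≤ N := le_trans (le_max_right _ _) hN
  have hx := le_logHt_xQ h2
  have hB := hN₂ N hN2
  have hroot' : bev P ((xQ N : ℚ) : ℝ) (r : ℝ) = 0 := by rw [xQ_cast]; exact hroot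
  rcases hpar (xQ N) r hroot' with hsmall | ⟨t, htx, hty⟩
  · exfalso; linarith
  · have h1 := hCφ t
    have h2' := hCψ t
    rw [htx] at h1
    rw [hty] at h2'
    have hφ0 : (0 : ℝ) ≤ dφ := Nat.cast_nonneg dφ
    have hψ0 : (0 : ℝ) ≤ dψ := Nat.cast_nonneg dψ
    have e1 : (dψ : ℝ) * logHt (xQ N) ≤ dψ * (dφ * logHt t + Cφ) := mul_le_mul_of_nonneg_left h1.2 hψ0
    have e2 : (dφ : ℝ) * ((dψ : ℝ) * logHt t) ≤ dφ * (logHt r + Cψ) :=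
      mul_le_mul_of_nonneg_left (by linarith [h2'.1]) hφ0
    have e3 : (dφ : ℝ) * logHt r ≤ dφ * (dψ * logHt t + Cψ) := mul_le_mul_of_nonneg_left h2'.2 hφ0
    have e4 : (dψ : ℝ) * ((dφ : ℝ) * logHt t) ≤ dψ * (logHt (xQ N) + Cφ) :=
      mul_le_mul_of_nonneg_left (by linarith [h1.1]) hψ0
    have e5 : (dψ : ℝ) * ((dφ : ℝ) * logHt t) = dφ * ((dψ : ℝ) * logHt t) := by ring
    constructor <;> linarith

/-- **THEOREM A′ (class II, hypothesis-free).**  A `ℚ`-parametrised curve with `dφ < m₀ · dψ` (`dφ = deg φ` the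
degree of the abscissa, `dψ = deg ψ`): `ThinFibreAt m₀ P`, every `m₀`, every top, NO `HeightComparison`. -/
theorem thinFibreAt_of_param {P : ℤ[X][X]} {φ₁ φ₂ ψ₁ ψ₂ : ℚ[X]} (hφ : IsCoprime φ₁ φ₂) (hψ : IsCoprime ψ₁ ψ₂)
    {B : ℝ} (hpar : ∀ x y : ℚ, bev P x y = 0 → logHt x ≤ B ∨
      ∃ t : ℚ, aeval t φ₁ / aeval t φ₂ = x ∧ aeval t ψ₁ / aeval t ψ₂ = y)
    {dφ dψ : ℕ} (hdφ : max φ₁.natDegree φ₂.natDegree = dφ) (hdψ : max ψ₁.natDegree ψ₂.natDegree = dψ)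
    {m₀ : ℕ} (hlt : dφ < m₀ * dψ) : ThinFibreAt m₀ P := by
  obtain ⟨c, N₁, htr⟩ := param_transfer hφ hψ hpar hdφ hdψ
  exact thinFibreAt_of_transfer (fun N hN r hroot => (htr N hN r hroot).1) hlt

/-- **THEOREM B′ (class II, hypothesis-free).**  `m₀ · dψ < dφ` (`m₀ ≥ 1`): `ThinFibreAt m₀ P ↔ BddLevelEmpty P`. -/
theorem thinFibreAt_iff_bddLevelEmpty_of_param {P : ℤ[X][X]} {φ₁ φ₂ ψ₁ ψ₂ : ℚ[X]} (hφ : IsCoprime φ₁ φ₂)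
    (hψ : IsCoprime ψ₁ ψ₂) {B : ℝ} (hpar : ∀ x y : ℚ, bev P x y = 0 → logHt x ≤ B ∨
      ∃ t : ℚ, aeval t φ₁ / aeval t φ₂ = x ∧ aeval t ψ₁ / aeval t ψ₂ = y)
    {dφ dψ : ℕ} (hdφ : max φ₁.natDegree φ₂.natDegree = dφ) (hdψ : max ψ₁.natDegree ψ₂.natDegree = dψ)
    {m₀ : ℕ} (hm : 1 ≤ m₀) (hlt : m₀ * dψ < dφ) : ThinFibreAt m₀ P ↔ BddLevelEmpty P := by
  obtain ⟨c, N₁, htr⟩ := param_transfer hφ hψ hpar hdφ hdψ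
  exact ⟨bddLevelEmpty_of_thinFibreAt_of_transfer (fun N hN r hroot => (htr N hN r hroot).2) hm hlt,
    fun h => thinFibreAt_of_bddLevelEmpty h m₀⟩

/-- points of a finite set have bounded height. -/
theorem logHt_le_sum_of_mem {E : Finset ℚ} {x : ℚ} (hx : x ∈ E) : logHt x ≤ ∑ e ∈ E, logHt e :=
  Finset.single_le_sum (fun e _ => logHt_nonneg e) hx

/-- THEOREM A′ with a finite exceptional set of abscissae `E : Finset ℚ` (finite BY TYPE). -/
theorem thinFibreAt_of_param_finset {P : ℤ[X][X]} {φ₁ φ₂ ψ₁ ψ₂ : ℚ[X]} (hφ : IsCoprime φ₁ φ₂)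
    (hψ : IsCoprime ψ₁ ψ₂) (E : Finset ℚ)
    (hpar : ∀ x y : ℚ, bev P x y = 0 → x ∉ E → ∃ t : ℚ, aeval t φ₁ / aeval t φ₂ = x ∧ aeval t ψ₁ / aeval t ψ₂ = y)
    {dφ dψ : ℕ} (hdφ : max φ₁.natDegree φ₂.natDegree = dφ) (hdψ : max ψ₁.natDegree ψ₂.natDegree = dψ)
    {m₀ : ℕ} (hlt : dφ < m₀ * dψ) : ThinFibreAt m₀ P := by
  refine thinFibreAt_of_param hφ hψ (B := ∑ e ∈ E, logHt e) (fun x y h => ?_) hdφ hdψ hlt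
  by_cases hx : x ∈ E
  · exact Or.inl (logHt_le_sum_of_mem hx)
  · exact Or.inr (hpar x y h hx)

/-- THEOREM A′ in the checklist's reading (K-g53 (4)): parametrisation with NON-VANISHING denominators inside the
conclusion — a special case of `thinFibreAt_of_param_finset` (whose hypothesis is weaker). -/
theorem thinFibreAt_of_param_finset' {P : ℤ[X][X]} {φ₁ φ₂ ψ₁ ψ₂ : ℚ[X]} (hφ : IsCoprime φ₁ φ₂)
    (hψ : IsCoprime ψ₁ ψ₂) (E : Finset ℚ)
    (hpar : ∀ x y : ℚ, bev P x y = 0 → x ∉ E →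
      ∃ t : ℚ, aeval t φ₂ ≠ 0 ∧ aeval t ψ₂ ≠ 0 ∧ x = aeval t φ₁ / aeval t φ₂ ∧ y = aeval t ψ₁ / aeval t ψ₂)
    {dφ dψ : ℕ} (hdφ : max φ₁.natDegree φ₂.natDegree = dφ) (hdψ : max ψ₁.natDegree ψ₂.natDegree = dψ)
    {m₀ : ℕ} (hlt : dφ < m₀ * dψ) : ThinFibreAt m₀ P :=
  thinFibreAt_of_param_finset hφ hψ E (fun x y h hx => by
    obtain ⟨t, -, -, hx', hy'⟩ := hpar x y h hx
    exact ⟨t, hx'.symm, hy'.symm⟩) hdφ hdψ hlt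

/-- THEOREM B′ with a finite exceptional set. -/
theorem thinFibreAt_iff_bddLevelEmpty_of_param_finset {P : ℤ[X][X]} {φ₁ φ₂ ψ₁ ψ₂ : ℚ[X]} (hφ : IsCoprime φ₁ φ₂)
    (hψ : IsCoprime ψ₁ ψ₂) (E : Finset ℚ)
    (hpar : ∀ x y : ℚ, bev P x y = 0 → x ∉ E → ∃ t : ℚ, aeval t φ₁ / aeval t φ₂ = x ∧ aeval t ψ₁ / aeval t ψ₂ = y)
    {dφ dψ : ℕ} (hdφ : max φ₁.natDegree φ₂.natDegree = dφ) (hdψ : max ψ₁.natDegree ψ₂.natDegree = dψ)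
    {m₀ : ℕ} (hm : 1 ≤ m₀) (hlt : m₀ * dψ < dφ) : ThinFibreAt m₀ P ↔ BddLevelEmpty P := by
  refine thinFibreAt_iff_bddLevelEmpty_of_param hφ hψ (B := ∑ e ∈ E, logHt e) (fun x y h => ?_) hdφ hdψ hm hlt
  by_cases hx : x ∈ E
  · exact Or.inl (logHt_le_sum_of_mem hx)
  · exact Or.inr (hpar x y h hx)

/-- **THEOREM B′⁼ (class II, BOUNDARY INCLUDED, every `m₀`).**  Same data as A′ with `1 ≤ dψ` and `m₀ · dψ ≤ dφ`:
`ThinFibreAt m₀ P ↔ BddLevelEmpty P`. -/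
theorem thinFibreAt_iff_bddLevelEmpty_of_param_le {P : ℤ[X][X]} {φ₁ φ₂ ψ₁ ψ₂ : ℚ[X]} (hφ : IsCoprime φ₁ φ₂)
    (hψ : IsCoprime ψ₁ ψ₂) {B : ℝ} (hpar : ∀ x y : ℚ, bev P x y = 0 → logHt x ≤ B ∨
      ∃ t : ℚ, aeval t φ₁ / aeval t φ₂ = x ∧ aeval t ψ₁ / aeval t ψ₂ = y)
    {dφ dψ : ℕ} (hdφ : max φ₁.natDegree φ₂.natDegree = dφ) (hdψ : max ψ₁.natDegree ψ₂.natDegree = dψ)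
    (hdψ1 : 1 ≤ dψ) {m₀ : ℕ} (hle : m₀ * dψ ≤ dφ) : ThinFibreAt m₀ P ↔ BddLevelEmpty P := by
  obtain ⟨c, N₁, htr⟩ := param_transfer hφ hψ hpar hdφ hdψ
  exact ⟨bddLevelEmpty_of_thinFibreAt_of_transfer_le (fun N hN r hroot => (htr N hN r hroot).2) hdψ1 hle,
    fun h => thinFibreAt_of_bddLevelEmpty h m₀⟩

/-- **COMPLETE DICHOTOMY on class II (no undecided boundary)**, `1 ≤ dψ`, every `m₀`. -/
theorem thinFibreAt_or_iff_bddLevelEmpty_of_param {P : ℤ[X][X]} {φ₁ φ₂ ψ₁ ψ₂ : ℚ[X]} (hφ : IsCoprime φ₁ φ₂)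
    (hψ : IsCoprime ψ₁ ψ₂) {B : ℝ} (hpar : ∀ x y : ℚ, bev P x y = 0 → logHt x ≤ B ∨
      ∃ t : ℚ, aeval t φ₁ / aeval t φ₂ = x ∧ aeval t ψ₁ / aeval t ψ₂ = y)
    {dφ dψ : ℕ} (hdφ : max φ₁.natDegree φ₂.natDegree = dφ) (hdψ : max ψ₁.natDegree ψ₂.natDegree = dψ)
    (hdψ1 : 1 ≤ dψ) (m₀ : ℕ) : ThinFibreAt m₀ P ∨ (ThinFibreAt m₀ P ↔ BddLevelEmpty P) := by
  rcases Nat.lt_or_ge dφ (m₀ * dψ) with h | h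
  · exact Or.inl (thinFibreAt_of_param hφ hψ hpar hdφ hdψ h)
  · exact Or.inr (thinFibreAt_iff_bddLevelEmpty_of_param_le hφ hψ hpar hdφ hdψ hdψ1 h)

/-- [class] definition (census convention): **the `ℚ`-PARAMETRISED CLASS at quality `m₀`** — every rational point of
`P = 0` off a set of bounded abscissa-height is `(φ(t), ψ(t))`, `t ∈ ℚ`, for coprime pairs `φ = φ₁/φ₂`, `ψ = ψ₁/ψ₂`
over `ℚ` with `deg φ < m₀ · deg ψ`. -/
def ParamAt (m₀ : ℕ) (P : ℤ[X][X]) : Prop :=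
  ∃ φ₁ φ₂ ψ₁ ψ₂ : ℚ[X], ∃ B : ℝ, IsCoprime φ₁ φ₂ ∧ IsCoprime ψ₁ ψ₂ ∧
    max φ₁.natDegree φ₂.natDegree < m₀ * max ψ₁.natDegree ψ₂.natDegree ∧
    ∀ x y : ℚ, bev P x y = 0 → logHt x ≤ B ∨
      ∃ t : ℚ, aeval t φ₁ / aeval t φ₂ = x ∧ aeval t ψ₁ / aeval t ψ₂ = y

/-- **every curve of the parametrised class is decided at `m₀` — hypothesis-free.** -/
theorem thinFibreAt_of_paramAt {m₀ : ℕ} {P : ℤ[X][X]} (h : ParamAt m₀ P) : ThinFibreAt m₀ P := by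
  obtain ⟨φ₁, φ₂, ψ₁, ψ₂, B, hφ, hψ, hlt, hpar⟩ := h
  exact thinFibreAt_of_param hφ hψ hpar rfl rfl hlt

/-- the classes increase with `m₀`. -/
theorem ParamAt.mono {m₀ m : ℕ} (hle : m₀ ≤ m) {P : ℤ[X][X]} (h : ParamAt m₀ P) : ParamAt m P := by
  obtain ⟨φ₁, φ₂, ψ₁, ψ₂, B, hφ, hψ, hlt, hpar⟩ := h
  exact ⟨φ₁, φ₂, ψ₁, ψ₂, B, hφ, hψ, lt_of_lt_of_le hlt (Nat.mul_le_mul_right _ hle), hpar⟩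

end Summit.Schanuel.Schanuel.Theorems.RootDecomp1KHeightMachine

end
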